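import Summits.ValiantsHypothesis.ValiantsHypothesis.Theorems.ApBlock
import Summits.ValiantsHypothesis.ValiantsHypothesis.Theorems.NcPerWordTensor
import HarnessLib

/-!
# Noncommutative syntactically multilinear circuits for `AP_k` need `2^{Ω(k)}` gates
# (Hrubeš–Wigderson–Yehudayoff Thm 1.12, a DECIDED rung of the commutativity dial — kernel)

Decomposition workshop `decomp-valiant`, lens 6 «restricted-models lifting axis», gen 4, move K5c of
the node `CommutativityDial`. The dial's open conjunct `A_nc = PerNotNcVP` concerns NONCOMMUTATIVE
circuits for the ORDERED permanent `PERM_n = AP_n^{(ord)}`; the node-of-record crux 23661 concerns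
SYNTACTICALLY MULTILINEAR commutative circuits for `per_n`. In the model satisfying BOTH restrictions at
once — noncommutative (`CommutativityDial.ncEval`) AND syntactically multilinear
(`IsSyntacticallyMultilinear`, the tree's predicate, same syntax) — an exponential lower bound is a
THEOREM for the all-permutations polynomial `AP_k = Σ_σ x_{σ(1)} ⋯ x_{σ(k)}` (HWY10 Thm 1.12), and this
file proves it in the kernel:

* `apPoly k : FreeAlgebra F (Fin k)`;
* `choose_le_of_computes_apPoly` — if a fan-in-two, syntactically multilinear circuit `P` has
  `ncEval P = apPoly k` (`k ≥ 4`), then `C(k, d) ≤ (k + 1) · P.size` for some `k/3 ≤ d < 2k/3`; since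
  `C(k,d) ≥ C(k,⌈k/3⌉) ≥ (27/4)^{k/3} / (k+1)` on that range, `P.size ≥ 2^{Ω(k)}`.

PROOF (a parse-tree-free rendering of HWY §F.2): (1) SUPPORT DISCIPLINE — every monomial (word) of
every gate value has its letters inside the gate's syntactic variable set
(`NcSupport.letters_subset_of_mem_supp`);
(2) THE BALANCED BLOCK (`ApBlock.exists_block`) — by induction along the gate list, every word `w` of length
`≥ 2k/3` occurring in a gate value factors as `w = α·γ·β` where `γ` (of length in `[k/3, 2k/3)`) is a
word of the value of an earlier gate `v` and the letters of `α, β` AVOID the syntactic variable set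
`X_v` of `v` (this is where syntactic multilinearity bites: at a product gate the cofactor's letters
live in the sibling's variable set, which is disjoint from `X_v`); (3) COUNTING (`card_blockSet_le`) —
for `AP_k` every permutation word `σ` therefore has a gate `v` and a position `p` with
`σ({p, …, p+d-1}) = X_v`, `d = |X_v| ∈ [k/3, 2k/3)`; for fixed `(v, p)` at most `d!·(k-d)!`
permutations do this (restriction to the block and to its complement are embeddings), so
`k! ≤ P.size · (k+1) · max_d d!(k-d)!`, i.e. `C(k,d) ≤ (k+1)·P.size` for the maximising `d`.

HONEST FRAMING: HWY10 Thm 1.12 reproved (with an explicit constant) in the tree's coordinates; the lower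
bound is for `AP_k`, NOT for its ordered version `PERM_k` (for ordered polynomials syntactic
multilinearity is automatic, HWY §F.1, and the bound would be `A_nc` itself); nothing here bears on
`VP ≠ VNP`.

## References
* [HrubesWigdersonYehudayoff2010] P. Hrubeš, A. Wigderson, A. Yehudayoff, Relationless completeness and
  separations, CCC 2010 / ECCC TR10-021, §F.2: Lemma F.2, Lemma F.3, Thm 1.12.
* [RazYehudayoff2008] R. Raz, A. Yehudayoff, Lower bounds and separations for constant depth
  multilinear circuits, CCC 2008, §2 (syntactic multilinearity).
-/

namespace Summit.ValiantsHypothesis.ValiantsHypothesis.Theorems.ApLowerBound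

open Literature.Computability.AlgebraicComplexity
open Literature.Computability.AlgebraicComplexity.ArithCircuit hiding ncGateValues ncEval
open Summit.ValiantsHypothesis.ValiantsHypothesis.Theorems.CommutativityDial
open scoped Pointwise

universe u v

open Summit.ValiantsHypothesis.ValiantsHypothesis.Theorems.NcSupport
open Summit.ValiantsHypothesis.ValiantsHypothesis.Theorems.ApBlock

section AP

variable (F : Type) [Field F]

/-! ## §5 The all-permutations polynomial and the block count (HWY Lemma F.3, Thm 1.12) -/

/-- The ALL-PERMUTATIONS polynomial `AP_k = Σ_{σ ∈ S_k} x_{σ(0)} x_{σ(1)} ⋯ x_{σ(k-1)}` in `k`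
noncommuting variables. [cite: HrubesWigdersonYehudayoff2010, §F.2] -/
noncomputable def apPoly (k : ℕ) : FreeAlgebra F (Fin k) :=
  ∑ σ : Equiv.Perm (Fin k), (List.ofFn fun t => FreeAlgebra.ι F (σ t)).prod

variable {F}

/-- The coefficient of the permutation word `σ(0)σ(1)⋯σ(k-1)` in `AP_k` is `1`.
[cite: HrubesWigdersonYehudayoff2010, §F.2] -/
theorem coeff_apPoly_perm {k : ℕ} (σ : Equiv.Perm (Fin k)) :
    (FreeAlgebra.equivMonoidAlgebraFreeMonoid (apPoly F k)).coeff
      (FreeMonoid.ofList (List.ofFn ⇑σ)) = 1 := by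
  classical
  unfold apPoly
  simp only [map_sum, NcPerWordTensor.equiv_prod_ofFn_ι, MonoidAlgebra.coeff_sum,
    Finsupp.finsetSum_apply]
  have h : ∀ τ : Equiv.Perm (Fin k),
      (Finsupp.single (FreeMonoid.ofList (List.ofFn ⇑τ)) (1 : F)) (FreeMonoid.ofList (List.ofFn ⇑σ)) =
        if τ = σ then 1 else 0 := by
    intro τ
    rw [Finsupp.single_apply]
    refine if_congr ?_ rfl rfl
    rw [EmbeddingLike.apply_eq_iff_eq, List.ofFn_inj, DFunLike.coe_fn_eq]
  simp_rw [MonoidAlgebra.coeff_single, h]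
  rw [Finset.sum_ite_eq']
  simp

/-- Every permutation word is a support word of `AP_k`. [cite: HrubesWigdersonYehudayoff2010, §F.2] -/
theorem permWord_mem_supp {k : ℕ} (σ : Equiv.Perm (Fin k)) :
    FreeMonoid.ofList (List.ofFn ⇑σ) ∈ supp (apPoly F k) := by
  rw [supp, Finsupp.mem_support_iff, coeff_apPoly_perm]
  exact one_ne_zero

/-- Trichotomy of positions in a three-fold concatenation. [folklore] -/
theorem getElem_append3 {α : Type v} (A G B : List α) (t : ℕ) (ht : t < (A ++ G ++ B).length) :
    (t < A.length → (A ++ G ++ B)[t] ∈ A) ∧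
      (A.length ≤ t → t < A.length + G.length → (A ++ G ++ B)[t] ∈ G) ∧
      (A.length + G.length ≤ t → (A ++ G ++ B)[t] ∈ B) := by
  simp only [List.length_append] at ht
  refine ⟨fun h => ?_, fun h h' => ?_, fun h => ?_⟩
  · rw [List.getElem_append_left (by simp; omega), List.getElem_append_left h]
    exact List.getElem_mem _
  · rw [List.getElem_append_left (by simp; omega), List.getElem_append_right h]
    exact List.getElem_mem _
  · rw [List.getElem_append_right (by simp; omega)]
    exact List.getElem_mem _

/-- The BLOCK SET of `(S, p, d)`: permutations mapping exactly the positions `p, …, p + d - 1` into `S`.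
[cite: HrubesWigdersonYehudayoff2010, Lemma F.3] -/
noncomputable def blockSet (k : ℕ) (S : Finset (Fin k)) (p d : ℕ) : Finset (Equiv.Perm (Fin k)) :=
  Finset.univ.filter fun σ => ∀ t : Fin k, (p ≤ (t : ℕ) ∧ (t : ℕ) < p + d) ↔ σ t ∈ S

/-- **Block count** (HWY Lemma F.3): at most `d!·(k-d)!` permutations map exactly the position block
`[p, p+d)` onto a fixed `d`-set `S` — restriction to the block is an embedding into `S`, restriction to
the other positions an embedding into `Sᶜ`. [cite: HrubesWigdersonYehudayoff2010, Lemma F.3] -/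
theorem card_blockSet_le {k : ℕ} (S : Finset (Fin k)) {p d : ℕ} (hpd : p + d ≤ k) (hS : S.card = d) :
    (blockSet k S p d).card ≤ Nat.factorial d * Nat.factorial (k - d) := by
  let bp : Fin d → Fin k := fun i => ⟨p + i, by omega⟩
  let cp : Fin (k - d) → Fin k := fun j =>
    if (j : ℕ) < p then ⟨j, by omega⟩ else ⟨j + d, by omega⟩
  have hbp : ∀ σ ∈ blockSet k S p d, ∀ i, σ (bp i) ∈ S := fun σ hσ i =>
    ((Finset.mem_filter.1 hσ).2 (bp i)).1 ⟨by simp [bp], by simp [bp]⟩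
  have hcp : ∀ σ ∈ blockSet k S p d, ∀ j, σ (cp j) ∈ Sᶜ := by
    intro σ hσ j
    rw [Finset.mem_compl]
    intro h
    have := ((Finset.mem_filter.1 hσ).2 (cp j)).2 h
    by_cases hj : (j : ℕ) < p
    · simp [cp, hj] at this
      omega
    · simp [cp, hj] at this
  let enc : {σ // σ ∈ blockSet k S p d} → (Fin d ↪ ↥S) × (Fin (k - d) ↪ ↥(Sᶜ)) := fun σ =>
    (⟨fun i => ⟨σ.1 (bp i), hbp σ.1 σ.2 i⟩, fun i i' h => by
        have := σ.1.injective (congrArg Subtype.val h)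
        simp only [bp, Fin.mk.injEq] at this
        exact Fin.ext (by omega)⟩,
     ⟨fun j => ⟨σ.1 (cp j), hcp σ.1 σ.2 j⟩, fun j j' h => by
        have := congrArg Fin.val (σ.1.injective (congrArg Subtype.val h))
        by_cases hj : (j : ℕ) < p <;> by_cases hj' : (j' : ℕ) < p <;>
          simp [cp, hj, hj'] at this <;> exact Fin.ext (by omega)⟩)
  have henc : Function.Injective enc := by
    rintro ⟨σ, hσ⟩ ⟨σ', hσ'⟩ h
    simp only [enc, Prod.mk.injEq, Function.Embedding.mk.injEq] at h
    obtain ⟨h₁, h₂⟩ := h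
    refine Subtype.ext (Equiv.ext fun t => ?_)
    by_cases ht : p ≤ (t : ℕ) ∧ (t : ℕ) < p + d
    · have e : t = bp ⟨t - p, by omega⟩ := Fin.ext (by simp [bp]; omega)
      have := congrFun h₁ ⟨t - p, by omega⟩
      rw [Subtype.mk.injEq] at this
      rw [e]; exact this
    · have e : t = cp ⟨if (t : ℕ) < p then t else t - d, by split_ifs <;> omega⟩ := by
        by_cases htp : (t : ℕ) < p
        · exact Fin.ext (by simp [cp, htp])
        · refine Fin.ext ?_
          have h1 : ¬ ((t : ℕ) - d < p) := by omega
          simp [cp, htp, h1]; omega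
      have := congrFun h₂ ⟨if (t : ℕ) < p then t else t - d, by split_ifs <;> omega⟩
      rw [Subtype.mk.injEq] at this
      rw [e]; exact this
  calc (blockSet k S p d).card = Fintype.card {σ // σ ∈ blockSet k S p d} :=
        (Fintype.card_coe _).symm
    _ ≤ Fintype.card ((Fin d ↪ ↥S) × (Fin (k - d) ↪ ↥(Sᶜ))) :=
        Fintype.card_le_of_injective enc henc
    _ = Nat.factorial d * Nat.factorial (k - d) := by
        rw [Fintype.card_prod, Fintype.card_embedding_eq, Fintype.card_embedding_eq,
          Fintype.card_coe, Fintype.card_coe, Finset.card_compl, hS, Fintype.card_fin,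
          Fintype.card_fin, Fintype.card_fin, Nat.descFactorial_self, Nat.descFactorial_self]

/-- READING A FACTORISATION AS A BLOCK: if the permutation word of `σ` is `α·γ·β` with the letters
of `γ` inside `S` and those of `α, β` outside, then `σ` maps exactly the positions
`[|α|, |α| + |γ|)` into `S`, `|S| = |γ|`, and `|α| + |γ| + |β| = k`.
[cite: HrubesWigdersonYehudayoff2010, Lemma F.3] -/
theorem mem_blockSet_of_eq {k : ℕ} (σ : Equiv.Perm (Fin k)) (S : Finset (Fin k))
    (α γ β : FreeMonoid (Fin k)) (h : FreeMonoid.ofList (List.ofFn ⇑σ) = α * γ * β)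
    (hγ : letters γ ⊆ S) (hαβ : Disjoint (letters α ∪ letters β) S) :
    σ ∈ blockSet k S α.length γ.length ∧ S.card = γ.length ∧
      α.length + γ.length + β.length = k := by
  have hL : List.ofFn ⇑σ =
      FreeMonoid.toList α ++ FreeMonoid.toList γ ++ FreeMonoid.toList β := by
    rw [← FreeMonoid.toList_ofList (List.ofFn ⇑σ), h, FreeMonoid.toList_mul, FreeMonoid.toList_mul]
  have eα : (FreeMonoid.toList α).length = α.length := rfl
  have eγ : (FreeMonoid.toList γ).length = γ.length := rfl
  have eβ : (FreeMonoid.toList β).length = β.length := rfl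
  have hlen : α.length + γ.length + β.length = k := by
    have := congrArg List.length hL
    simp only [List.length_ofFn, List.length_append] at this
    omega
  have hl3 : (FreeMonoid.toList α ++ FreeMonoid.toList γ ++ FreeMonoid.toList β).length = k := by
    rw [← hL, List.length_ofFn]
  have hσt : ∀ t : Fin k, σ t =
      (FreeMonoid.toList α ++ FreeMonoid.toList γ ++ FreeMonoid.toList β)[(t : ℕ)]'
        (by rw [hl3]; exact t.isLt) := by
    intro t
    have e : σ t = (List.ofFn ⇑σ)[(t : ℕ)]'(by rw [List.length_ofFn]; exact t.isLt) := by
      rw [List.getElem_ofFn]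
    rw [e]
    exact List.getElem_of_eq hL _
  rw [Finset.disjoint_union_left] at hαβ
  have hblock : ∀ t : Fin k, (α.length ≤ (t : ℕ) ∧ (t : ℕ) < α.length + γ.length) ↔ σ t ∈ S := by
    intro t
    obtain ⟨i1, i2, i3⟩ := getElem_append3 (FreeMonoid.toList α) (FreeMonoid.toList γ)
      (FreeMonoid.toList β) t (by rw [hl3]; exact t.isLt)
    rw [hσt t]
    constructor
    · rintro ⟨ha, hb⟩
      exact hγ (List.mem_toFinset.2 (i2 (by omega) (by omega)))
    · intro hS
      by_contra hne
      rcases not_and_or.1 hne with ha | hb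
      · exact Finset.disjoint_left.1 hαβ.1 (List.mem_toFinset.2 (i1 (by omega))) hS
      · exact Finset.disjoint_left.1 hαβ.2 (List.mem_toFinset.2 (i3 (by omega))) hS
  refine ⟨Finset.mem_filter.2 ⟨Finset.mem_univ _, hblock⟩, ?_, hlen⟩
  have hS : S = (Finset.univ : Finset (Fin γ.length)).image
      (fun i : Fin γ.length => σ ⟨α.length + (i : ℕ), by omega⟩) := by
    ext s
    constructor
    · intro hs
      have ht := (hblock (σ.symm s)).2 (by rwa [Equiv.apply_symm_apply])
      refine Finset.mem_image.2 ⟨⟨(σ.symm s : ℕ) - α.length, by omega⟩, Finset.mem_univ _, ?_⟩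
      have e : (⟨α.length + ((σ.symm s : ℕ) - α.length), by omega⟩ : Fin k) = σ.symm s :=
        Fin.ext (by simp only; omega)
      rw [e, Equiv.apply_symm_apply]
    · intro hs
      obtain ⟨i, _, rfl⟩ := Finset.mem_image.1 hs
      exact (hblock _).1 ⟨by simp, by simp [i.isLt]⟩
  rw [hS, Finset.card_image_of_injective _ (fun (i i' : Fin γ.length) e => Fin.ext (by
    have := congrArg Fin.val (σ.injective e); simp only at this; omega)),
    Finset.card_univ, Fintype.card_fin]

/-- **HWY Theorem 1.12 (kernel)**: a fan-in-two, syntactically multilinear circuit computing `AP_k`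
NONCOMMUTATIVELY (`k ≥ 4`) has `(k + 1) · size ≥ C(k, d)` for some `k/3 ≤ d < 2k/3` — hence size
`≥ C(k, ⌈k/3⌉)/(k+1) = 2^{Ω(k)}`. [cite: HrubesWigdersonYehudayoff2010, Thm 1.12] -/
theorem choose_le_of_computes_apPoly {k : ℕ} (hk : 4 ≤ k) (P : ArithCircuit F (Fin k))
    (h2 : P.IsFanInTwo) (hsm : IsSyntacticallyMultilinear P) (hP : ncEval P = apPoly F k) :
    ∃ d, k ≤ 3 * d ∧ 3 * d < 2 * k ∧ k.choose d ≤ (k + 1) * P.size := by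
  let dg : ℕ → ℕ := fun j => ((gateVarSets P.gates).getD j ∅).card
  let good : Finset ℕ := (Finset.range P.size).filter fun j => k ≤ 3 * dg j ∧ 3 * dg j < 2 * k
  have cover : ∀ σ : Equiv.Perm (Fin k), ∃ j ∈ good, ∃ p, p + dg j ≤ k ∧
      σ ∈ blockSet k ((gateVarSets P.gates).getD j ∅) p (dg j) := by
    intro σ
    have hw : FreeMonoid.ofList (List.ofFn ⇑σ) ∈
        supp (ncOperandEval (ncGateValues P.gates) P.output) := by
      show _ ∈ supp (ncEval P)
      rw [hP]
      exact permWord_mem_supp σ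
    have hlenσ : (FreeMonoid.ofList (List.ofFn ⇑σ)).length = k := by
      simp [FreeMonoid.length]
    rcases mem_supp_ncOperandEval hw with ⟨x, _, hx⟩ | ⟨c, _, hc⟩ | ⟨i, _, hi, hwi⟩
    · exfalso
      have := congrArg FreeMonoid.length hx
      rw [hlenσ, FreeMonoid.length_of] at this
      omega
    · exfalso
      have := congrArg FreeMonoid.length hc
      rw [hlenσ] at this
      simp at this
      omega
    · rw [length_ncGateValues] at hi
      obtain ⟨j, hji, α, γ, β, h, hγ, h1, h3, hd, _⟩ :=
        exists_block k hk P.gates h2 (fun i args h => hsm i args h) i _ hwi (by rw [hlenσ]; omega)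
      obtain ⟨hmem, hcard, hlen⟩ := mem_blockSet_of_eq σ _ α γ β h
        (letters_subset_of_mem_supp P.gates hγ) hd
      have hdg : dg j = γ.length := hcard
      refine ⟨j, Finset.mem_filter.2 ⟨Finset.mem_range.2 ?_, ?_⟩, α.length, ?_, ?_⟩
      · unfold ArithCircuit.size; omega
      · rw [hdg]; exact ⟨h1, h3⟩
      · rw [hdg]; omega
      · rw [hdg]; exact hmem
  have hne : good.Nonempty := by
    obtain ⟨j, hj, _⟩ := cover 1
    exact ⟨j, hj⟩
  obtain ⟨j₀, hj₀, hmax⟩ :=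
    Finset.exists_max_image good (fun j => Nat.factorial (dg j) * Nat.factorial (k - dg j)) hne
  have hcount : Nat.factorial k ≤
      P.size * ((k + 1) * (Nat.factorial (dg j₀) * Nat.factorial (k - dg j₀))) := by
    calc Nat.factorial k = (Finset.univ : Finset (Equiv.Perm (Fin k))).card := by
          rw [Finset.card_univ, Fintype.card_perm, Fintype.card_fin]
      _ ≤ (good.biUnion fun j => (Finset.range (k + 1)).biUnion fun p =>
            if p + dg j ≤ k then blockSet k ((gateVarSets P.gates).getD j ∅) p (dg j) else ∅).card := by
          refine Finset.card_le_card fun σ _ => ?_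
          obtain ⟨j, hj, p, hp, hσ⟩ := cover σ
          refine Finset.mem_biUnion.2 ⟨j, hj, Finset.mem_biUnion.2 ⟨p, Finset.mem_range.2 (by omega), ?_⟩⟩
          rw [if_pos hp]
          exact hσ
      _ ≤ ∑ j ∈ good, ∑ p ∈ Finset.range (k + 1),
            (if p + dg j ≤ k then blockSet k ((gateVarSets P.gates).getD j ∅) p (dg j) else ∅).card :=
          Finset.card_biUnion_le.trans (Finset.sum_le_sum fun j _ => Finset.card_biUnion_le)
      _ ≤ ∑ j ∈ good, ∑ p ∈ Finset.range (k + 1), Nat.factorial (dg j) * Nat.factorial (k - dg j) := by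
          refine Finset.sum_le_sum fun j _ => Finset.sum_le_sum fun p _ => ?_
          split_ifs with hp
          · exact card_blockSet_le _ hp rfl
          · simp
      _ ≤ ∑ j ∈ good, ∑ p ∈ Finset.range (k + 1),
            Nat.factorial (dg j₀) * Nat.factorial (k - dg j₀) :=
          Finset.sum_le_sum fun j hj => Finset.sum_le_sum fun p _ => hmax j hj
      _ = good.card * ((k + 1) * (Nat.factorial (dg j₀) * Nat.factorial (k - dg j₀))) := by
          rw [Finset.sum_const, Finset.sum_const, Finset.card_range, smul_eq_mul, smul_eq_mul]
      _ ≤ P.size * ((k + 1) * (Nat.factorial (dg j₀) * Nat.factorial (k - dg j₀))) := by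
          refine Nat.mul_le_mul_right _ ((Finset.card_filter_le _ _).trans ?_)
          rw [Finset.card_range]
  have hgood := (Finset.mem_filter.1 hj₀).2
  refine ⟨dg j₀, hgood.1, hgood.2, ?_⟩
  have hdk : dg j₀ ≤ k := by omega
  have hpos : 0 < Nat.factorial (dg j₀) * Nat.factorial (k - dg j₀) :=
    Nat.mul_pos (Nat.factorial_pos _) (Nat.factorial_pos _)
  refine Nat.le_of_mul_le_mul_right ?_ hpos
  calc k.choose (dg j₀) * (Nat.factorial (dg j₀) * Nat.factorial (k - dg j₀)) = Nat.factorial k := by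
        rw [← mul_assoc, Nat.choose_mul_factorial_mul_factorial hdk]
    _ ≤ P.size * ((k + 1) * (Nat.factorial (dg j₀) * Nat.factorial (k - dg j₀))) := hcount
    _ = (k + 1) * P.size * (Nat.factorial (dg j₀) * Nat.factorial (k - dg j₀)) := by ring

end AP

end Summit.ValiantsHypothesis.ValiantsHypothesis.Theorems.ApLowerBound
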